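import Summits.Ventures.Crystal3D.Theorems.StickyWulffConstantPolycrystalWulffBoundFreeEnergyExterior
import Summits.Ventures.Crystal3D.Theorems.StickyWulffConstantPolycrystalWulffBoundSeparated
import Summits.Ventures.Crystal3D.Theorems.StickyWulffConstantPolycrystalWulffBoundSameLattice

/-!
# `PolycrystalWulffBound`, line `PolyDensity`: polyhedral textures whose grains share ONE lattice

Route `StickyWulffConstant` of the venture `Summits/Ventures/Crystal3D`, crux `PolycrystalWulffBound`
(item `stmt-Ventures-19482`), second prover lane (poly-p2).  A rung not in the planner's list but
immediate from the exterior calculus, generalising eng's `polycrystalWulffBound_two_sameLattice`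
(`n = 2`) to EVERY `n` (polyhedral grains): if all grains carry the same point lattice
(`A f '' Λ = A g '' Λ` for all `f, g`; the frames may differ by lattice symmetries, the wall data
`c, m` are arbitrary), then `6·2^{1/3}·(√2·Vol)^{2/3} ≤ En`.

Proof: all Wulff bodies coincide (`wulffBody_eq_of_image_eq`), so by the wall identity
`sum_iota_eq_sum_per_sub_per` the free part of `En` is EXACTLY `Per_W(E)` (`E = ⋃ f, G f`); the
one-grain Wulff inequality `polycrystalWulffBound_singleGrain` for `E`; wall terms are `≥ 0`
(`iota_nonneg_of_poly`, charges `≥ 0`).  The case `n = 0` is the empty texture.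
WHAT THIS IS NOT: a registered stub; nothing on textures with two lattices; the crux is not claimed.
-/

noncomputable section

open scoped BigOperators InnerProductSpace ENNReal
open MeasureTheory Filter

namespace Summit.Ventures.Crystal3D.Cruxes.PolycrystalWulffBound.PolyDensity

open Summit.Ventures.Crystal3D.Theorems
open Summit.Ventures.Crystal3D.Cruxes.TextureLiminf.TexShadow (per polytope E3)
open Literature.MathematicalPhysics.StatisticalMechanics (perimeter)

/-- **Same-lattice polyhedral textures satisfy the polycrystal Wulff bound** (every `n`, arbitrary
wall data): the free energy is exactly `Per_W(⋃ f, G f)` and the walls cost `≥ 0`. -/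
theorem rung_sameLattice :
    let Λ : Set (EuclideanSpace ℝ (Fin 3)) := Literature.MathematicalPhysics.StatisticalMechanics.fccStacking 1 (Real.sqrt (2 / 3));
    let Brl : (ℤ → ℤ) → Set (EuclideanSpace ℝ (Fin 3)) := Literature.MathematicalPhysics.StatisticalMechanics.barlowStacking 1 (Real.sqrt (2 / 3));
    let Ax : EuclideanSpace ℝ (Fin 3) → (EuclideanSpace ℝ (Fin 3) ≃ₗᵢ[ℝ] EuclideanSpace ℝ (Fin 3)) → (EuclideanSpace ℝ (Fin 3) ≃ₗᵢ[ℝ] EuclideanSpace ℝ (Fin 3)) → Prop := fun m A B => ∃ (L : EuclideanSpace ℝ (Fin 3) ≃ₗᵢ[ℝ] EuclideanSpace ℝ (Fin 3)) (s₁ s₂ : EuclideanSpace ℝ (Fin 3)) (σ σ' : ℤ → ℤ), Literature.MathematicalPhysics.StatisticalMechanics.IsHaggSeq σ ∧ Literature.MathematicalPhysics.StatisticalMechanics.IsHaggSeq σ' ∧ L (EuclideanSpace.single (2 : Fin 3) (1 : ℝ)) = m ∧ A '' Λ ⊆ (fun q => L q + s₁) '' Brl σ ∧ B '' Λ ⊆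 (fun q => L q + s₂) '' Brl σ';
    let CoAx : (EuclideanSpace ℝ (Fin 3) ≃ₗᵢ[ℝ] EuclideanSpace ℝ (Fin 3)) → (EuclideanSpace ℝ (Fin 3) ≃ₗᵢ[ℝ] EuclideanSpace ℝ (Fin 3)) → Prop := fun A B => ∃ m, Ax m A B;
    let Φ : EuclideanSpace ℝ (Fin 3) → ℝ := fun ν => Real.sqrt 2 / 4 * ∑ᶠ w ∈ {w ∈ Λ | ‖w‖ = 1}, |⟪w, ν⟫_ℝ|;
    let Per : Set (EuclideanSpace ℝ (Fin 3)) → Set (EuclideanSpace ℝ (Fin 3)) → ℝ := fun K S => (⨆ (ξ : EuclideanSpace ℝ (Fin 3) → EuclideanSpace ℝ (Fin 3)) (_ : ContDiff ℝ 1 ξ ∧ HasCompactSupport ξ ∧ ∀ z, ξ z ∈ K), ENNReal.ofReal (∫ z in S, Literature.MathematicalPhysics.StatisticalMechanics.fieldDivergence ξ z)).toReal;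
    let ι : Set (EuclideanSpace ℝ (Fin 3)) → Set (EuclideanSpace ℝ (Fin 3)) → Set (EuclideanSpace ℝ (Fin 3)) → ℝ := fun K S₁ S₂ => (Per K S₁ + Per K S₂ - Per K (S₁ ∪ S₂)) / 2;
    let W : (EuclideanSpace ℝ (Fin 3) ≃ₗᵢ[ℝ] EuclideanSpace ℝ (Fin 3)) → Set (EuclideanSpace ℝ (Fin 3)) := fun A => {y | ∀ ν : EuclideanSpace ℝ (Fin 3), ⟪y, ν⟫_ℝ ≤ Φ (A.symm ν)};
    let Dsc : EuclideanSpace ℝ (Fin 3) → Set (EuclideanSpace ℝ (Fin 3)) := fun m => {y | ‖y‖ ≤ 1 ∧ ⟪y, m⟫_ℝ = 0};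
    let Tex : (n : ℕ) → (Fin n → Set (EuclideanSpace ℝ (Fin 3))) → (Fin n → (EuclideanSpace ℝ (Fin 3) ≃ₗᵢ[ℝ] EuclideanSpace ℝ (Fin 3))) → (Fin n → Fin n → ℝ) → (Fin n → Fin n → EuclideanSpace ℝ (Fin 3)) → Prop := fun n G A c m => (∀ f : Fin n, Literature.MathematicalPhysics.StatisticalMechanics.HasFinitePerimeter (G f) ∧ volume (G f) < ⊤) ∧ (∀ f g, f ≠ g → Disjoint (G f) (G g)) ∧ (∀ f g, f ≠ g → 0 ≤ c f g) ∧ (∀ f g, f ≠ g → ¬ CoAx (A f) (A g) → m f g = 0 ∧ 1 ≤ c f g) ∧ (∀ f g, f ≠ g → CoAx (A f) (A g) → A f '' Λ ≠ A g '' Λ → Ax (m f g) (A f) (A g) ∧ 1 / 2 ≤ c f g);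
    let En : (n : ℕ) → (Fin n → Set (EuclideanSpace ℝ (Fin 3))) → (Fin n → (EuclideanSpace ℝ (Fin 3) ≃ₗᵢ[ℝ] EuclideanSpace ℝ (Fin 3))) → (Fin n → Fin n → ℝ) → (Fin n → Fin n → EuclideanSpace ℝ (Fin 3)) → ℝ := fun n G A c m => ∑ f : Fin n, Per (W (A f)) (G f) - ∑ f, ∑ g, (if f = g then 0 else ι (W (A f)) (G f) (G g)) + ∑ f, ∑ g, (if f = g then 0 else c f g / 2 * ι (Dsc (m f g)) (G f) (G g));
    let Vol : (n : ℕ) → (Fin n → Set (EuclideanSpace ℝ (Fin 3))) → ℝ := fun n G => (volume (⋃ f : Fin n, G f)).toReal;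
    let Poly : Set (EuclideanSpace ℝ (Fin 3)) → Prop := fun S => ∃ (k : ℕ) (H : Fin k → Finset ((EuclideanSpace ℝ (Fin 3)) × ℝ)), S = ⋃ i, ⋂ p ∈ H i, {x | ⟪p.1, x⟫_ℝ < p.2};
    ∀ (n : ℕ) (G : Fin n → Set (EuclideanSpace ℝ (Fin 3))) (A : Fin n → (EuclideanSpace ℝ (Fin 3) ≃ₗᵢ[ℝ] EuclideanSpace ℝ (Fin 3))) (c : Fin n → Fin n → ℝ) (m : Fin n → Fin n → EuclideanSpace ℝ (Fin 3)), Tex n G A c m → (∀ f, Poly (G f)) → (∀ f g, A f '' Λ = A g '' Λ) → 6 * (2 : ℝ) ^ ((1 : ℝ) / 3) * (Real.sqrt 2 * Vol n G) ^ ((2 : ℝ) / 3) ≤ En n G A c m  := by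
  intro Λ Brl Ax CoAx Φ Per ι W Dsc Tex En Vol Poly n G A c m hTex hPoly hsame
  obtain ⟨hfin, hdisj, hc0, -, -⟩ := hTex
  have hvol : ∀ f, volume (G f) < ⊤ := fun f => (hfin f).2
  obtain ⟨hEm, hEv, hEp, -⟩ := texture_union_facts G hfin hdisj
  have hDc : ∀ v : E3, IsCompact (Dsc v) := fun v =>
    Metric.isCompact_of_isClosed_isBounded
      ((isClosed_le continuous_norm continuous_const).inter
        (isClosed_eq (continuous_id.inner continuous_const) continuous_const))
      (Metric.isBounded_closedBall.subset (cruxDisc_subset_closedBall v))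
  -- the wall terms are nonnegative
  have hwalls : 0 ≤ ∑ f, ∑ g, (if f = g then 0 else c f g / 2 * ι (Dsc (m f g)) (G f) (G g)) := by
    refine Finset.sum_nonneg fun f _ => Finset.sum_nonneg fun g _ => ?_
    by_cases hfg : f = g
    · rw [if_pos hfg]
    · rw [if_neg hfg]
      have hnn := iota_nonneg_of_poly G hPoly hvol hdisj (hDc (m f g)) (convex_cruxDisc (m f g))
        (zero_mem_cruxDisc (m f g)) hfg
      show 0 ≤ c f g / 2 * ((per (Dsc (m f g)) (G f) + per (Dsc (m f g)) (G g) -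
        per (Dsc (m f g)) (G f ∪ G g)) / 2)
      exact mul_nonneg (div_nonneg (hc0 f g hfg) zero_le_two) (div_nonneg hnn zero_le_two)
  by_cases hn : n = 0
  · -- the empty texture
    subst hn
    show 6 * (2 : ℝ) ^ ((1 : ℝ) / 3) * (Real.sqrt 2 * (volume (⋃ f : Fin 0, G f)).toReal) ^ ((2 : ℝ) / 3) ≤
      ∑ f : Fin 0, Per (W (A f)) (G f) -
        ∑ f : Fin 0, ∑ g : Fin 0, (if f = g then 0 else ι (W (A f)) (G f) (G g)) +
        ∑ f : Fin 0, ∑ g : Fin 0, (if f = g then 0 else c f g / 2 * ι (Dsc (m f g)) (G f) (G g))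
    rw [Set.iUnion_of_empty, measure_empty, ENNReal.toReal_zero, mul_zero,
      Real.zero_rpow (by norm_num), mul_zero]
    simp
  obtain ⟨f₀⟩ : Nonempty (Fin n) := ⟨⟨0, Nat.pos_of_ne_zero hn⟩⟩
  -- all Wulff bodies coincide
  set K : Set E3 := W (A f₀) with hK
  have hW : ∀ f, W (A f) = K := fun f => wulffBody_eq_of_image_eq (hsame f f₀)
  have hKc : IsCompact K := isCompact_cruxWulffBody (A f₀)
  have hKv : Convex ℝ K := convex_cruxWulffBody (A f₀)
  have hK0 : (0 : E3) ∈ K := zero_mem_cruxWulffBody (A f₀)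
  have hKs : -K = K := neg_cruxWulffBody_eq (A f₀)
  -- the free energy is exactly `Per_W(E)`
  have hid : (∑ f, ∑ g, (if f = g then 0 else (per K (G f) + per K (G g) - per K (G f ∪ G g)) / 2)) =
      (∑ f, per K (G f)) - per K (⋃ f, G f) :=
    sum_iota_eq_sum_per_sub_per G hPoly hvol hdisj hKc hKv hK0 hKs
  -- the one-grain Wulff inequality for `E`
  have hWulff : 6 * (2 : ℝ) ^ ((1 : ℝ) / 3) * (Real.sqrt 2 * Vol n G) ^ ((2 : ℝ) / 3) ≤
      per K (⋃ f, G f) :=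
    polycrystalWulffBound_singleGrain (A f₀) ⟨hEm, lt_top_iff_ne_top.2 hEp⟩ hEv
  show 6 * (2 : ℝ) ^ ((1 : ℝ) / 3) * (Real.sqrt 2 * Vol n G) ^ ((2 : ℝ) / 3) ≤
    ∑ f, per (W (A f)) (G f) -
      ∑ f, ∑ g, (if f = g then 0 else
        (per (W (A f)) (G f) + per (W (A f)) (G g) - per (W (A f)) (G f ∪ G g)) / 2) +
      ∑ f, ∑ g, (if f = g then 0 else c f g / 2 * ι (Dsc (m f g)) (G f) (G g))
  simp only [hW]
  linarith

end Summit.Ventures.Crystal3D.Cruxes.PolycrystalWulffBound.PolyDensity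

end
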